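import Literature.NumberTheory.Transcendental.NesterenkoElimination
import Literature.RingTheory.MvPolynomial.HomogeneousHilbertFunction
import Literature.RingTheory.MvPolynomial.HomogeneousDimension
import Mathlib.Algebra.MvPolynomial.NoZeroDivisors
import HarnessLib

/-!
# Monotonicity and truncation of the Hilbert function of a homogeneous prime (toolkit for `CycleAPIAt 3`)

Crux `Summit.Schanuel.Schanuel.Theses.DiophantineDichotomy.ApproximationProperty`
(stmt-Schanuel-6117), line `orbit-interpolation-determinant`, registered stub `CycleAPIAt3 : CycleAPIAt 3`
(siege). In the `t = 3` descent the third cut is a box principle modulo the selected prime CURVE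
`𝔭₂ ⊂ ℚ[x₀, …, x₃]` (rank `2`), whose strength is the Hilbert function `H(𝔭₂; b)` in degree
`b = O(Δ)`; the one lower bound available for free (lead c1's CASE 1,
`Cruxes/ApproximationProperty/NOTES.md` §`t = 3`) is the **truncation bound**

  `H(𝔭; t) ≥ H((Q); d)`  for all `d ≤ t` with `d < g`,

where `Q ∈ 𝔭` and `g` is such that every form of `𝔭` of degree `< g` is divisible by `Q` (for
`𝔭 ∋ Q₁` with `Q₁` irreducible, `g = g₀ =` the least degree of a form of `𝔭` outside `(Q₁)`).
It rests on two facts of graded commutative algebra proved here in all numbers of variables: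

* `HilbertTruncation.hilbert_mono` — the Hilbert function `t ↦ H(I; t) = dim S_t − dim I_t` of a
  homogeneous ideal admitting a LINEAR non-zero-divisor `ℓ` is non-decreasing (the exact sequence
  `0 → (S/I)_t →·ℓ (S/I)_{t+1} → (S/(I,ℓ))_{t+1} → 0`, i.e. the tree's hypersurface-section formula
  `Literature.RingTheory.MvPolynomial.hilbert_sup_span_add_hilbert_eq` with `q = 1`);
  `HilbertTruncation.hilbert_mono_of_isPrime` — in particular for a homogeneous PRIME missing a
  variable (every relevant prime: `exists_X_notMem_of_ringKrullDim_ne_zero`);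
* `HilbertTruncation.idealDegree_eq_of_forall_dvd` — if `Q ∈ 𝔭` and every form of `𝔭` of degree
  `d` is divisible by `Q` then `𝔭_d = (Q)_d`;
* `HilbertTruncation.finrank_idealDegree_span_singleton_add`, `…_of_lt` — the Hilbert function of a
  principal ideal: `dim (Q)_{t+a} = dim S_t` and `(Q)_d = 0` for `d < a = deg Q`
  (`finrank_idealDegree_sup_span_add_eq` with `I = 0`);
* `hilbert_truncation` — the truncation bound above, for `ℚ[x₀, …, x_m]` (registered helper stub).

Homogeneity of ideals is taken in the instance-free form "`I` contains the homogeneous components of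
its members" (`Ideal.IsHomogeneous` for Mathlib's `MvPolynomial.gradedAlgebra`, through
`MvPolynomial.decomposition.decompose'_apply`). Proofs only: no new definitions.
Sources: Nesterenko–Philippon (eds.), LNM 1752 (2001), Ch. 3 §4, Ch. 4 §4; Hartshorne, Algebraic
Geometry I.7 (Hilbert functions); Philippon, Bull. SMF 114 (1986) Lemme 3.1 (the section formula).
-/

set_option linter.dupNamespace false

noncomputable section

namespace Summit.Schanuel.Schanuel.Cruxes.ApproximationProperty.OrbitInterpolationDeterminant

open MvPolynomial Module
open Literature.RingTheory.MvPolynomial (idealDegree mem_idealDegree idealDegree_bot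
  finrank_idealDegree_le finrank_idealDegree_sup_span_add_eq hilbert_sup_span_add_hilbert_eq
  exists_X_notMem_of_ringKrullDim_ne_zero)

namespace HilbertTruncation

variable {K : Type*} [Field K] {σ : Type*}

/-! ## Instance-free homogeneity -/

/-- An ideal containing the homogeneous components of its members is homogeneous for Mathlib's
grading `MvPolynomial.gradedAlgebra` (used through `letI` in the proofs below). [folklore] -/
theorem isHomogeneous_of_forall_mem {I : Ideal (MvPolynomial σ K)}
    (hI : ∀ f ∈ I, ∀ d : ℕ, homogeneousComponent d f ∈ I) :
    letI := MvPolynomial.gradedAlgebra (σ := σ) (R := K)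
    I.IsHomogeneous (homogeneousSubmodule σ K) := by
  letI := MvPolynomial.gradedAlgebra (σ := σ) (R := K)
  intro i f hf
  have e : (DirectSum.decompose (homogeneousSubmodule σ K) f i : MvPolynomial σ K) =
      homogeneousComponent i f :=
    MvPolynomial.decomposition.decompose'_apply f i
  rw [e]
  exact hI f hf i

/-- `(Q)` contains the homogeneous components of its members when `Q` is homogeneous. [folklore] -/
theorem forall_mem_span_singleton {Q : MvPolynomial σ K} {a : ℕ} (hQ : Q.IsHomogeneous a) :
    ∀ f ∈ Ideal.span {Q}, ∀ d : ℕ, homogeneousComponent d f ∈ Ideal.span ({Q} : Set _) := by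
  letI := MvPolynomial.gradedAlgebra (σ := σ) (R := K)
  have hhom : (Ideal.span {Q}).IsHomogeneous (homogeneousSubmodule σ K) :=
    Ideal.homogeneous_span _ _ fun x hx => ⟨a, by rw [Set.mem_singleton_iff.mp hx]; exact hQ⟩
  intro f hf d
  exact homogeneousComponent_mem_of_mem hhom hf d

/-! ## Monotonicity under a linear non-zero-divisor -/

/-- **One step**: `H(I; t) ≤ H(I; t+1)` when `I` (homogeneous) admits a linear non-zero-divisor `ℓ`
(from `H(I + (ℓ); t+1) + H(I; t) = H(I; t+1)`). [cite: Philippon1986, Lemme 3.1] -/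
theorem hilbert_le_succ [Finite σ] {I : Ideal (MvPolynomial σ K)}
    (hI : ∀ f ∈ I, ∀ d : ℕ, homogeneousComponent d f ∈ I) {ℓ : MvPolynomial σ K}
    (hℓ : ℓ.IsHomogeneous 1) (hℓ0 : ℓ ≠ 0) (hnzd : ∀ f, ℓ * f ∈ I → f ∈ I) (t : ℕ) :
    finrank K ↥(homogeneousSubmodule σ K t) - finrank K ↥(idealDegree I t) ≤
      finrank K ↥(homogeneousSubmodule σ K (t + 1)) - finrank K ↥(idealDegree I (t + 1)) := by
  letI := MvPolynomial.gradedAlgebra (σ := σ) (R := K)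
  have h := hilbert_sup_span_add_hilbert_eq (isHomogeneous_of_forall_mem hI) hℓ0 hℓ hnzd t
  omega

/-- **Monotonicity**: `s ≤ t → H(I; s) ≤ H(I; t)` when `I` admits a linear non-zero-divisor.
[cite: Philippon1986, Lemme 3.1] -/
theorem hilbert_mono [Finite σ] {I : Ideal (MvPolynomial σ K)}
    (hI : ∀ f ∈ I, ∀ d : ℕ, homogeneousComponent d f ∈ I) {ℓ : MvPolynomial σ K}
    (hℓ : ℓ.IsHomogeneous 1) (hℓ0 : ℓ ≠ 0) (hnzd : ∀ f, ℓ * f ∈ I → f ∈ I) {s t : ℕ} (hst : s ≤ t) :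
    finrank K ↥(homogeneousSubmodule σ K s) - finrank K ↥(idealDegree I s) ≤
      finrank K ↥(homogeneousSubmodule σ K t) - finrank K ↥(idealDegree I t) := by
  induction hst with
  | refl => exact le_rfl
  | step _ ih => exact ih.trans (hilbert_le_succ hI hℓ hℓ0 hnzd _)

/-- **Monotonicity for primes**: a homogeneous prime missing a variable has a non-decreasing Hilbert
function (the variable is a linear non-zero-divisor). [folklore] -/
theorem hilbert_mono_of_isPrime [Finite σ] {𝔭 : Ideal (MvPolynomial σ K)} (h𝔭 : 𝔭.IsPrime)
    (hI : ∀ f ∈ 𝔭, ∀ d : ℕ, homogeneousComponent d f ∈ 𝔭) (hX : ∃ i, (X i : MvPolynomial σ K) ∉ 𝔭)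
    {s t : ℕ} (hst : s ≤ t) :
    finrank K ↥(homogeneousSubmodule σ K s) - finrank K ↥(idealDegree 𝔭 s) ≤
      finrank K ↥(homogeneousSubmodule σ K t) - finrank K ↥(idealDegree 𝔭 t) := by
  obtain ⟨i, hi⟩ := hX
  exact hilbert_mono hI (isHomogeneous_X K i) (X_ne_zero i)
    (fun f hf => ((h𝔭.mem_or_mem hf).resolve_left hi)) hst

/-- A homogeneous prime of positive Krull codimension-complement (`dim S/𝔭 ≠ 0`, e.g. any prime that
is `IsUnmixedOfRank 𝔭 r` with `r ≠ 0`) misses a variable, so its Hilbert function is non-decreasing.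
[folklore] -/
theorem hilbert_mono_of_ringKrullDim_ne_zero [Finite σ] {𝔭 : Ideal (MvPolynomial σ K)}
    (h𝔭 : 𝔭.IsPrime) (hI : ∀ f ∈ 𝔭, ∀ d : ℕ, homogeneousComponent d f ∈ 𝔭)
    (hdim : ringKrullDim (MvPolynomial σ K ⧸ 𝔭) ≠ 0) {s t : ℕ} (hst : s ≤ t) :
    finrank K ↥(homogeneousSubmodule σ K s) - finrank K ↥(idealDegree 𝔭 s) ≤
      finrank K ↥(homogeneousSubmodule σ K t) - finrank K ↥(idealDegree 𝔭 t) :=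
  haveI := h𝔭
  hilbert_mono_of_isPrime h𝔭 hI (exists_X_notMem_of_ringKrullDim_ne_zero hdim) hst

/-! ## Truncation: degrees in which `𝔭` is generated by one form -/

/-- If `Q ∈ 𝔭` and every form of `𝔭` of degree `d` is divisible by `Q`, then `𝔭_d = (Q)_d`.
[folklore] -/
theorem idealDegree_eq_of_forall_dvd {𝔭 : Ideal (MvPolynomial σ K)} {Q : MvPolynomial σ K}
    (hQ : Q ∈ 𝔭) {d : ℕ} (hdvd : ∀ F ∈ 𝔭, F.IsHomogeneous d → Q ∣ F) :
    idealDegree 𝔭 d = idealDegree (Ideal.span {Q}) d := by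
  apply le_antisymm
  · intro F hF
    rw [mem_idealDegree] at hF ⊢
    exact ⟨Ideal.mem_span_singleton.mpr (hdvd F hF.1 hF.2), hF.2⟩
  · exact Literature.RingTheory.MvPolynomial.idealDegree_mono
      ((Ideal.span_singleton_le_iff_mem _).mpr hQ) d

/-- **Truncation bound** (general form): for a homogeneous prime `𝔭` missing a variable, `Q ∈ 𝔭`,
and a degree `d ≤ t` in which every form of `𝔭` is divisible by `Q`, `H((Q); d) ≤ H(𝔭; t)`.
[folklore] -/
theorem hilbert_span_singleton_le [Finite σ] {𝔭 : Ideal (MvPolynomial σ K)} (h𝔭 : 𝔭.IsPrime)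
    (hI : ∀ f ∈ 𝔭, ∀ d : ℕ, homogeneousComponent d f ∈ 𝔭) (hX : ∃ i, (X i : MvPolynomial σ K) ∉ 𝔭)
    {Q : MvPolynomial σ K} (hQ : Q ∈ 𝔭) {d t : ℕ} (hdt : d ≤ t)
    (hdvd : ∀ F ∈ 𝔭, F.IsHomogeneous d → Q ∣ F) :
    finrank K ↥(homogeneousSubmodule σ K d) - finrank K ↥(idealDegree (Ideal.span {Q}) d) ≤
      finrank K ↥(homogeneousSubmodule σ K t) - finrank K ↥(idealDegree 𝔭 t) := by
  rw [← idealDegree_eq_of_forall_dvd hQ hdvd]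
  exact hilbert_mono_of_isPrime h𝔭 hI hX hdt

/-! ## The Hilbert function of a principal ideal -/

/-- `dim (Q)_{t+a} = dim S_t` for a non-zero form `Q` of degree `a` (section of the zero ideal by
the non-zero-divisor `Q`). [folklore] -/
theorem finrank_idealDegree_span_singleton_add [Finite σ] {Q : MvPolynomial σ K} {a : ℕ}
    (hQ : Q.IsHomogeneous a) (hQ0 : Q ≠ 0) (t : ℕ) :
    finrank K ↥(idealDegree (Ideal.span {Q}) (t + a)) = finrank K ↥(homogeneousSubmodule σ K t) := by
  letI := MvPolynomial.gradedAlgebra (σ := σ) (R := K)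
  have h := finrank_idealDegree_sup_span_add_eq (I := (⊥ : Ideal (MvPolynomial σ K)))
    (Ideal.IsHomogeneous.bot _) hQ0 hQ
    (fun f hf => by
      rw [Ideal.mem_bot] at hf ⊢
      exact (mul_eq_zero.mp hf).resolve_left hQ0) t
  rw [bot_sup_eq, idealDegree_bot, idealDegree_bot, finrank_bot, add_zero, zero_add] at h
  exact h

/-- `(Q)_d = 0` for `d < a = deg Q`, `Q ≠ 0`: a non-zero multiple of `Q` has a homogeneous
component of degree `≥ a`. [folklore] -/
theorem idealDegree_span_singleton_of_lt {Q : MvPolynomial σ K} {a : ℕ} (hQ : Q.IsHomogeneous a)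
    (hQ0 : Q ≠ 0) {d : ℕ} (hd : d < a) : idealDegree (Ideal.span {Q}) d = ⊥ := by
  rw [eq_bot_iff]
  intro F hF
  rw [mem_idealDegree] at hF
  obtain ⟨hFQ, hFd⟩ := hF
  rw [Submodule.mem_bot]
  by_contra hF0
  obtain ⟨G, rfl⟩ := Ideal.mem_span_singleton'.mp hFQ
  have hG0 : G ≠ 0 := fun h => hF0 (by rw [h, zero_mul])
  -- degrees: `totalDegree (G * Q) = totalDegree G + a ≥ a > d = totalDegree (G * Q)`
  have h1 : (G * Q).totalDegree = d := hFd.totalDegree hF0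
  have h2 : (G * Q).totalDegree = G.totalDegree + Q.totalDegree :=
    totalDegree_mul_of_isDomain hG0 hQ0
  have h3 : Q.totalDegree = a := hQ.totalDegree hQ0
  omega

/-- Hence `H((Q); d) = dim S_d` for `d < deg Q`. [folklore] -/
theorem finrank_idealDegree_span_singleton_of_lt {Q : MvPolynomial σ K} {a : ℕ}
    (hQ : Q.IsHomogeneous a) (hQ0 : Q ≠ 0) {d : ℕ} (hd : d < a) :
    finrank K ↥(idealDegree (Ideal.span {Q}) d) = 0 := by
  rw [idealDegree_span_singleton_of_lt hQ hQ0 hd, finrank_bot]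

/-- The two values of the Hilbert function of `(Q) ⊆ ℚ[x₀, …, x_m]`, `deg Q = a`, in binomial form:
`H((Q); d) = binom(d+m, d)` for `d < a` and `H((Q); t+a) = binom(t+a+m, t+a) − binom(t+m, t)`.
[folklore] -/
theorem hilbert_span_singleton_eq (m : ℕ) {Q : MvPolynomial (Fin (m + 1)) ℚ} {a : ℕ}
    (hQ : Q.IsHomogeneous a) (hQ0 : Q ≠ 0) :
    (∀ d : ℕ, d < a →
      finrank ℚ ↥(homogeneousSubmodule (Fin (m + 1)) ℚ d) -
        finrank ℚ ↥(idealDegree (Ideal.span {Q}) d) = (d + m).choose d) ∧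
    (∀ t : ℕ,
      finrank ℚ ↥(homogeneousSubmodule (Fin (m + 1)) ℚ (t + a)) -
        finrank ℚ ↥(idealDegree (Ideal.span {Q}) (t + a)) = (t + a + m).choose (t + a) - (t + m).choose t) := by
  have hS : ∀ n : ℕ, finrank ℚ ↥(homogeneousSubmodule (Fin (m + 1)) ℚ n) = (n + m).choose n := by
    intro n
    rw [Literature.RingTheory.HilbertSamuel.finrank_homogeneousSubmodule_fin,
      show n + (m + 1) - 1 = n + m by omega]
  refine ⟨fun d hd => ?_, fun t => ?_⟩
  · rw [finrank_idealDegree_span_singleton_of_lt hQ hQ0 hd, hS, Nat.sub_zero]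
  · rw [finrank_idealDegree_span_singleton_add hQ hQ0 t, hS, hS]

end HilbertTruncation

open Literature.NumberTheory.Transcendental.Nesterenko in
/-- **The truncation bound for the Hilbert function of a homogeneous prime of `ℚ[x₀, …, x_m]`**
(lead c1's CASE 1 inequality for the third cut of the `t = 3` descent): let `𝔭` be a homogeneous
prime (instance-free form) missing a variable, `Q ∈ 𝔭`, and `g` such that every form of `𝔭` of
degree `< g` is divisible by `Q`; then `H((Q); d) ≤ H(𝔭; t)` for all `d ≤ t` with `d < g` — the
Hilbert function of `𝔭` in degree `t` is at least the (explicit, `hilbert_span_singleton_eq`) Hilbert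
function of the hypersurface `(Q)` in any degree below `g`. [folklore] -/
theorem hilbert_truncation : ∀ (m : ℕ) (𝔭 : Ideal (Rx m)) (Q : Rx m) (g d t : ℕ),
    𝔭.IsPrime → (∀ f ∈ 𝔭, ∀ n : ℕ, homogeneousComponent n f ∈ 𝔭) → (∃ i, (X i : Rx m) ∉ 𝔭) →
    Q ∈ 𝔭 → (∀ F ∈ 𝔭, ∀ n : ℕ, n < g → F.IsHomogeneous n → Q ∣ F) → d < g → d ≤ t →
    Module.finrank ℚ ↥(homogeneousSubmodule (Fin (m + 1)) ℚ d) -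
        Module.finrank ℚ ↥(Literature.RingTheory.MvPolynomial.idealDegree (Ideal.span {Q}) d) ≤
      Module.finrank ℚ ↥(homogeneousSubmodule (Fin (m + 1)) ℚ t) -
        Module.finrank ℚ ↥(Literature.RingTheory.MvPolynomial.idealDegree 𝔭 t) := by
  intro m 𝔭 Q g d t h𝔭 hI hX hQ hdvd hdg hdt
  exact HilbertTruncation.hilbert_span_singleton_le h𝔭 hI hX hQ hdt
    (fun F hF hFd => hdvd F hF d hdg hFd)

end Summit.Schanuel.Schanuel.Cruxes.ApproximationProperty.OrbitInterpolationDeterminant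

end
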